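import Summits.BirchSwinnertonDyer.BirchSwinnertonDyer.Theorems.ByReductionTypeAtTwoOrdKatoHalfAtTwoIsoRelaxedOptimalExistsMember
import Summits.BirchSwinnertonDyer.BirchSwinnertonDyer.Theorems.ByReductionTypeAtTwoOrdKatoHalfAtTwoIsoArchOfLemma46
import Summits.BirchSwinnertonDyer.BirchSwinnertonDyer.Theorems.ByReductionTypeAtTwoOrdKatoHalfAtTwoIsoPosDiscRealSignature
import HarnessLib

/-!
# Route ByReductionTypeAtTwo, crux `OrdKatoHalfAtTwoIso` (stmt-BirchSwinnertonDyer-19573), line `steinberg-fibre-at-two`: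
# the relaxed roads RE-KEYED on Greenberg's PRINT Lemma 4.6 at `2` (h46) + Kato 17.4 (1) at `2` (hD from h17) instead of Aʳ

Seat `cruxlead-stmt-BirchSwinnertonDyer-19573-g8` (LEAD PROVER, MODE LINE; HOME `run/shared/lean/pub/bsd-2adic/`; `--supports`
stmt-BirchSwinnertonDyer-23921). Pen RC-436 / RC-438: the archimedean input of every relaxed road is «h46 PRINT
(`Greenberg1999.lemma46_relaxed_mod_selmer_infinite_rat_two`, p608868) + `D.IsTorsion` from Kato 17.4 (1) at `2` (h17), via the kernel door
`ArchOfLemma46.lengthAt_selmer_add_one_le_relaxed_of_lemma46`»; Aʳ (`ArchimedeanLambdaModTwoOrdAtTwo`, Summits `@[conjecture]` reserve) is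
retired from every registered and displayed list. This leaf re-glues, ONE theorem per door and nothing else: (§1) the flat-package data door
and (§2) the B7 UNCUT / child-23921 road of `…RelaxedOptimalExistsMember` (registered road of skeleton v19: R-opt∃♭ + h46 + Lim@2 upstairs +
Ferrero–Washington + Kato 17.4 (1)(2)@2), and (§3) w2's relaxed-genuine `0 < Δ` data door `relaxedColemanData_of_relaxedZeta_of_arch`
(p705378) with the §4 alternative doors of the skeleton (R⁺ + h46 + Q⁺ + R∞⁺ + modularity + Abbes–Ullmo + Kato 17.4 (1)(2)@2 ⇒ the
conjunct, the PAIR child 24097). HONEST FRAMING (cell bsd-2adic): BSD is not proved by any of this; the crux, its `0 < Δ` conjunct, the PAIR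
child 24097 and B7′ 23921 stay OPEN; every door is CONDITIONAL on the binders it displays; nothing is asserted about the memo texts.
-/

set_option autoImplicit false
set_option linter.dupNamespace false

noncomputable section

open scoped Classical MatrixGroups ModularForm NumberField
open CongruenceSubgroup WeierstrassCurve Field IsDedekindDomain NumberField
open Literature.NumberTheory.GaloisRepresentations
open Literature.NumberTheory.GaloisCohomology
open Literature.NumberTheory.EllipticCurves Literature.NumberTheory.EllipticCurves.ModularForms
open Literature.NumberTheory.EllipticCurves.Kato2004
  Literature.NumberTheory.EllipticCurves.Kato2004.EulerSystemValues
open Literature.NumberTheory.EllipticCurves.Rank1Residual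
  Summit.BirchSwinnertonDyer.Rank1Residual.X1.MuLambda
open Literature.NumberTheory.EllipticCurves.Greenberg1999
open Literature.NumberTheory.IwasawaTheory
open Summit.BirchSwinnertonDyer.Rank1Residual Summit.BirchSwinnertonDyer.Rank1Residual.X5
open Summit.BirchSwinnertonDyer.BirchSwinnertonDyer.Theorems.OrdKatoOptimalAtTwo
  Summit.BirchSwinnertonDyer.BirchSwinnertonDyer.Theorems.OrdKatoIntAtTwo
open Summit.BirchSwinnertonDyer.BirchSwinnertonDyer.Theses.ByReductionTypeAtTwo
open Summit.BirchSwinnertonDyer.BirchSwinnertonDyer.Theorems.AlignedTransportAtTwoFineRoad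

namespace Summit.BirchSwinnertonDyer.BirchSwinnertonDyer.Theorems.SteinbergFibreAtTwo

/-! ## §1 The flat-package data door keyed on (h46, hD) -/

/-- **The relaxed data at ONE good-ordinary curve `V` from a flat package with an arbitrary image predicate `Φ`, Greenberg's Lemma 4.6 at
`2` (h46, PRINT) and a TORSION Selmer dual datum `D`**: the constructed relaxed datum, the restriction `q : X^{rel} ↠ X`, the archimedean
clause `ℓ₍₂₎(X) + e ≤ ℓ₍₂₎(X^{rel})` with `e = 1` on `0 < Δ_V` (`ArchOfLemma46.lengthAt_selmer_add_one_le_relaxed_of_lemma46`) and `e = 0` on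
`Δ_V < 0` (`q` onto), the image clause transported verbatim. `relaxedData_of_flatPackage_of_arch` with hA ↦ (h46, hD).
[cite: GreenbergLNM1716, §4 Lemma 4.6 (p. 105) and Remark (pp. 106–107)] -/
theorem relaxedData_of_flatPackage_of_lemma46 (h46 : lemma46_relaxed_mod_selmer_infinite_rat_two)
    (V : WeierstrassCurve ℚ) [V.IsElliptic] [V.IsGloballyMinimal] (hord : IsOrdinaryAt V 2)
    {κ : ZpExtension ℚ 2} {γ : absoluteGaloisGroup ℚ} (hκ : κ.IsCyclotomic)
    (hγ : κ.IsTopGenerator γ) (D : V.SelmerDualData κ γ) (hD : D.IsTorsion) (Yr : V.FineSelmerDualDataRelaxedInf κ γ)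
    (Φ : IwasawaAlgebra 2 → Prop)
    (hpack : ∀ Dr : V.SelmerDualDataRelaxedInf κ γ,
      ∃ (P : Submodule (IwasawaAlgebra 2) (IwasawaAlgebra 2)) (M : Submodule (IwasawaAlgebra 2) P)
        (τ : P →ₛₗ[((IwasawaAlgebra.involEquiv 2).toRingEquiv : IwasawaAlgebra 2 →+* IwasawaAlgebra 2)] Dr.X)
        (π : Dr.X →ₗ[IwasawaAlgebra 2] Yr.X),
        (∀ m ∈ M, τ m = 0) ∧ Function.Surjective π ∧ Function.Exact τ π ∧
        ∀ G : IwasawaAlgebra 2, Φ G →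
          ∃ s : IwasawaAlgebra 2, s ∉ IwasawaAlgebra.augIdealP 2 ∧
            s * (PowerSeries.C (((2 : ℕ) : ℤ_[2]) ^ (if 0 < V.Δ then 1 else 0)) * G) ∈ Submodule.map P.subtype M) :
    ∃ (Xr : Type) (_ : AddCommGroup Xr) (_ : Module (IwasawaAlgebra 2) Xr)
      (θ : IwasawaAlgebra 2 ≃+* IwasawaAlgebra 2) (P : Submodule (IwasawaAlgebra 2) (IwasawaAlgebra 2))
      (M : Submodule (IwasawaAlgebra 2) P)
      (τ : P →ₛₗ[(θ : IwasawaAlgebra 2 →+* IwasawaAlgebra 2)] Xr) (π : Xr →ₗ[IwasawaAlgebra 2] Yr.X) (e : ℕ),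
      (∀ m ∈ M, τ m = 0) ∧ Function.Surjective π ∧ Function.Exact τ π ∧
      Module.lengthAt (IwasawaAlgebra 2) D.X
          ⟨IwasawaAlgebra.augIdealP 2, IwasawaAlgebra.isPrime_augIdealP_holds 2⟩ + e ≤
        Module.lengthAt (IwasawaAlgebra 2) Xr ⟨IwasawaAlgebra.augIdealP 2, IwasawaAlgebra.isPrime_augIdealP_holds 2⟩ ∧
      ∀ G : IwasawaAlgebra 2, Φ G →
        ∃ s : IwasawaAlgebra 2, s ∉ IwasawaAlgebra.augIdealP 2 ∧
          s * (PowerSeries.C (((2 : ℕ) : ℤ_[2]) ^ e) * G) ∈ Submodule.map P.subtype M := by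
  let Dr : V.SelmerDualDataRelaxedInf κ γ := V.selmerDualDataRelaxedInf κ hγ
  obtain ⟨q, hq⟩ := exists_relaxedSelmerRestrict V κ hγ Dr D
  have hqs := relaxedSelmerRestrict_surjective V κ Dr D q hq
  obtain ⟨P, M, τ, π, hτM, hπs, hπ, himg⟩ := hpack Dr
  refine ⟨Dr.X, inferInstance, inferInstance, (IwasawaAlgebra.involEquiv 2).toRingEquiv, P, M, τ, π,
    (if 0 < V.Δ then 1 else 0), hτM, hπs, hπ, ?_, himg⟩
  by_cases hΔ : 0 < V.Δ
  · rw [if_pos hΔ, Nat.cast_one]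
    exact ArchOfLemma46.lengthAt_selmer_add_one_le_relaxed_of_lemma46 V κ h46 hord hΔ hκ hγ D Dr hD q hq
  · rw [if_neg hΔ, Nat.cast_zero, add_zero]
    exact Module.lengthAt_le_of_surjective q hqs _

/-! ## §2 B7 UNCUT and child 23921 BY NAME from R-opt∃♭ + h46 + Lim@2 upstairs + Ferrero–Washington + Kato 17.4 (1)(2)@2 -/

/-- **B7 `KatoMuPartAtOptimalMemberOfNotSurjectiveTwo` (UNCUT) BY NAME from R-opt∃♭ (memo-exact), Greenberg's Lemma 4.6 at `2` (h46, PRINT),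
Lim 2017 Thm. 3.5 at `2` UPSTAIRS + Ferrero–Washington (relaxed (A₂) at the not-onto witness member) and Kato 17.4 (1) at `2` (h17: the
witness's Selmer dual is `Λ`-torsion).** Witness `W′ := W₁` (the ∃-member of R-opt∃♭; intended `E• = E₀/C₀`): `2^{μ(X)} ∣ 2^{μ(L₀)} ∣ L₀` for
every integral lift `L₀` of `ϖ·L₂(f, α_{W₁})` by w2's `mu_le_mu_of_relaxedColemanSemilinear_of_arch` at `G := L₀` with the data of §1; clause
(b) is the ∃-member text's own. NO Abbes–Ullmo, NO modularity datum, NO Greenberg 5.14, NO Aʳ. CONDITIONAL; nothing closed.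
[cite: GreenbergLNM1716, §4 Lemma 4.6 (p. 105) and Remark (pp. 106–107)] [cite: Lim2017FineSelmer, §3 Thm. 3.5 and Lemma 3.2]
[cite: FerreroWashington1979, Theorem] [cite: Kato2004Asterisque, Thm. 17.4 (1) (p. 273), §17.13 (pp. 279–280) (shape)] -/
theorem katoMuPartAtOptimalMember_of_existsMemberFlat_of_lemma46
    (hLim : Lim2017.thm35_at_two_upstairs_fineSelmer_twoTorsion_finite_of_classicalMuVanishes)
    (hFW : ferreroWashington1979_classicalMuVanishes)
    (hR : RelaxedZetaOptimalAtTwoExistsMemberFlat) (h46 : lemma46_relaxed_mod_selmer_infinite_rat_two)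
    (h17 : ∀ (V : WeierstrassCurve ℚ) [V.IsElliptic] [V.IsGloballyMinimal] [NeZero (V.conductorNorm ℤ)]
      (f : CuspForm (Gamma0 (V.conductorNorm ℤ)) 2), kato_divisibility_allPrimes V 2 (f := f)) :
    KatoMuPartAtOptimalMemberOfNotSurjectiveTwo := by
  intro W _ _ hcm hgo hns
  obtain ⟨W₁, _, _, hiso, hb, hpack⟩ := hR W hcm hgo hns
  have hns₁ : ¬ W₁.HasSurjectiveModNGaloisRep 2 := not_hasSurjectiveModNGaloisRep_two_of_isIsogenous W hns hiso
  refine ⟨W₁, ‹_›, ‹_›, hiso, ?_, hb⟩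
  intro κ γ hκ hγ hγ' hord _ f hf ϖ hϖf D L₀ hL₀
  have hD : D.IsTorsion := (h17 W₁ f κ γ hκ hγ hγ' hord hf D).1
  obtain ⟨Yr⟩ := W₁.nonempty_fineSelmerDualDataRelaxedInf κ hγ
  obtain ⟨Xr, _, _, θ, P, M, τ, π, e, hτM, -, hπ, harch, himg⟩ :=
    relaxedData_of_flatPackage_of_lemma46 h46 W₁ hord hκ hγ D hD Yr
      (fun L ↦ iwasawaToPowerSeries 2 L = PowerSeries.C (ϖ : ℚ_[2]) * padicLFunction f (unitRoot W₁ 2 : ℚ_[2]))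
      (fun Dr ↦ hpack f κ γ hκ hγ hγ' hf ϖ hϖf Dr Yr)
  by_cases hL0 : L₀ = 0
  · rw [hL0]; exact dvd_zero _
  have hμ : D.mu ≤ mu L₀ :=
    mu_le_mu_of_relaxedColemanSemilinear_of_arch (D := D) hL0 θ P M τ π hτM hπ (himg L₀ hL₀) harch
      (lengthAt_fineRelaxed_eq_zero_of_not_hasSurjectiveModNGaloisRep_of_limUpstairs_of_FW hLim hFW W₁ hns₁ hκ hγ Yr)
  calc (PowerSeries.C (((2 : ℕ) : ℤ_[2]) ^ D.mu) : IwasawaAlgebra 2)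
      ∣ PowerSeries.C (((2 : ℕ) : ℤ_[2]) ^ mu L₀) := map_dvd _ (pow_dvd_pow _ hμ)
    _ ∣ L₀ := C_pow_mu_dvd hL0

/-- **The route's child `OrdKatoMuPartOptimalAtTwo` (stmt-BirchSwinnertonDyer-23921, text = B7′ verbatim) BY NAME from R-opt∃♭, h46, Lim@2
upstairs, Ferrero–Washington and Kato 17.4 (1)(2) at `2`** (B7 ⇒ B7′, left disjunct; Greenberg 5.14 NOT consumed). CONDITIONAL; the item is NOT
closed by this; nothing asserted. [cite: GreenbergLNM1716, §4 Lemma 4.6 (p. 105)] [cite: Lim2017FineSelmer, §3 Thm. 3.5]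
[cite: FerreroWashington1979, Theorem] [cite: Kato2004Asterisque, Thm. 17.4 (1) (p. 273)] -/
theorem ordKatoMuPartOptimalAtTwo_of_existsMemberFlat_of_lemma46
    (hLim : Lim2017.thm35_at_two_upstairs_fineSelmer_twoTorsion_finite_of_classicalMuVanishes)
    (hFW : ferreroWashington1979_classicalMuVanishes)
    (hR : RelaxedZetaOptimalAtTwoExistsMemberFlat) (h46 : lemma46_relaxed_mod_selmer_infinite_rat_two)
    (h17 : ∀ (V : WeierstrassCurve ℚ) [V.IsElliptic] [V.IsGloballyMinimal] [NeZero (V.conductorNorm ℤ)]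
      (f : CuspForm (Gamma0 (V.conductorNorm ℤ)) 2), kato_divisibility_allPrimes V 2 (f := f)) :
    OrdKatoMuPartOptimalAtTwo :=
  katoMuPartOff514_of_katoMuPartAtOptimalMember
    (katoMuPartAtOptimalMember_of_existsMemberFlat_of_lemma46 hLim hFW hR h46 h17)

/-! ## §3 The relaxed-genuine `0 < Δ` road (w2 p705378 / lead p706938) keyed on (h46, modularity, h17) instead of Aʳ -/

/-- **R⁺ + h46 + modularity + Kato 17.4 (1) at `2` ⟹ the relaxed data of the `μ`-door `ordKatoHalfAtTwoIsoPosDisc_of_relaxedColeman_of_relaxedConjA`**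
(w2 p704497): w2's `relaxedColemanData_of_relaxedZeta_of_arch` (p705378) with the archimedean clause from
`ArchOfLemma46.lengthAt_selmer_add_one_le_relaxed_of_lemma46`; `D.IsTorsion` from Kato 17.4 (1) at `2` at the curve's newform (modularity
instantiates it). [cite: GreenbergLNM1716, §4 Lemma 4.6 (p. 105) and Remark (pp. 106–107)] [cite: Kato2004Asterisque, Thm. 17.4 (1) (p. 273)] -/
theorem relaxedColemanData_of_relaxedZeta_of_lemma46 (hR : RelaxedZetaColemanIotaPosDiscAtTwo)
    (h46 : lemma46_relaxed_mod_selmer_infinite_rat_two) (hMod : nonempty_modularParametrizationData)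
    (h17 : ∀ (V : WeierstrassCurve ℚ) [V.IsElliptic] [V.IsGloballyMinimal] [NeZero (V.conductorNorm ℤ)]
      (f : CuspForm (Gamma0 (V.conductorNorm ℤ)) 2), kato_divisibility_allPrimes V 2 (f := f)) :
    ∀ (W : WeierstrassCurve ℚ) [W.IsElliptic] [W.IsGloballyMinimal]
      {N : ℕ} [NeZero N] (f : CuspForm (Gamma0 N) 2) (κ : ZpExtension ℚ 2) (γ : absoluteGaloisGroup ℚ),
      κ.IsCyclotomic → IsOrdinaryAt W 2 → W.HasSurjectiveModNGaloisRep 2 → 0 < W.Δ →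
      κ.IsTopGenerator γ → IsCyclotomicVariable 2 γ → IsNewformOf W f →
      ∀ (D : W.SelmerDualData κ γ) (Yr : W.FineSelmerDualDataRelaxedInf κ γ),
        ∃ (Xr : Type) (_ : AddCommGroup Xr) (_ : Module (IwasawaAlgebra 2) Xr)
          (θ : IwasawaAlgebra 2 ≃+* IwasawaAlgebra 2) (P : Submodule (IwasawaAlgebra 2) (IwasawaAlgebra 2))
          (M : Submodule (IwasawaAlgebra 2) P)
          (τ : P →ₛₗ[(θ : IwasawaAlgebra 2 →+* IwasawaAlgebra 2)] Xr) (π : Xr →ₗ[IwasawaAlgebra 2] Yr.X) (e : ℕ),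
          (∀ m ∈ M, τ m = 0) ∧ Function.Surjective π ∧ Function.Exact τ π ∧
          Module.lengthAt (IwasawaAlgebra 2) D.X
              ⟨IwasawaAlgebra.augIdealP 2, IwasawaAlgebra.isPrime_augIdealP_holds 2⟩ + e ≤
            Module.lengthAt (IwasawaAlgebra 2) Xr ⟨IwasawaAlgebra.augIdealP 2, IwasawaAlgebra.isPrime_augIdealP_holds 2⟩ ∧
          ∀ G₁ : IwasawaAlgebra 2, iwasawaToPowerSeries 2 G₁ = padicLFunction f (unitRoot W 2 : ℚ_[2]) →
            ∃ s : IwasawaAlgebra 2, s ∉ IwasawaAlgebra.augIdealP 2 ∧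
              s * (PowerSeries.C (((2 : ℕ) : ℤ_[2]) ^ e) * G₁) ∈ Submodule.map P.subtype M := by
  intro W _ _ N _ f κ γ hκ hord h2 hΔ hγ hγ' hf D Yr
  haveI : ContinuousSMul ℤ_[2] (W.tateModule 2) := TateModule.continuousSMul_padicInt
  haveI : Module.Free ℤ_[2] (W.tateModule 2) := W.module_free_tateModule_holds 2
  haveI : Module.Finite ℤ_[2] (W.tateModule 2) := W.module_finite_tateModule_holds 2
  haveI : NeZero (W.conductorNorm ℤ) := ⟨(W.conductorNorm_pos_holds).ne'⟩
  -- `X` is `Λ`-torsion: Kato 17.4 (1) at `2` at the curve's own newform (modularity instantiates it)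
  obtain ⟨Dm⟩ := hMod W
  have hD : D.IsTorsion := (h17 W Dm.f κ γ hκ hγ hγ' hord Dm.isNewformOf D).1
  -- the CONSTRUCTED relaxed Selmer dual datum and its restriction `q : X^{rel} ↠ X`
  let Dr : W.SelmerDualDataRelaxedInf κ γ := W.selmerDualDataRelaxedInf κ hγ
  obtain ⟨q, hq⟩ := exists_relaxedSelmerRestrict W κ hγ Dr D
  obtain ⟨I, Z, P, ℓ, τ, π, -, hτℓ, hπs, hπ, himg⟩ := hR W f κ γ hκ hord h2 hΔ hγ hγ' hf Dr Yr
  refine ⟨Dr.X, inferInstance, inferInstance, (IwasawaAlgebra.involEquiv 2).toRingEquiv, P, Submodule.map ℓ Z, τ, π, 1,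
    ?_, hπs, hπ, ?_, fun G₁ hG₁ ↦ ?_⟩
  · rintro _ ⟨z, hz, rfl⟩
    exact hτℓ z hz
  · rw [Nat.cast_one]
    exact ArchOfLemma46.lengthAt_selmer_add_one_le_relaxed_of_lemma46 W κ h46 hord hΔ hκ hγ D Dr hD q hq
  · obtain ⟨s, hs, hsG⟩ := himg G₁ hG₁
    exact ⟨s, hs, by rw [← Submodule.map_comp]; exact hsG⟩

/-- **The `0 < Δ` conjunct `OrdKatoHalfAtTwoIsoPosDisc` BY NAME from R⁺ (memo), h46 (PRINT), Q⁺ (research) ∧ R∞⁺ (residual), modularity,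
Abbes–Ullmo and Kato 17.4 (1)(2) at `2`** — the lead g7 door `ordKatoHalfAtTwoIsoPosDisc_of_relaxedZeta_of_arch_of_conjA_of_realSignature` with
hA ↦ (h46, hMod, h17). CONDITIONAL; nothing closed. [cite: Kato2004Asterisque, Thm. 17.4 (1)(2) (p. 273), §17.13]
[cite: GreenbergLNM1716, §4 Lemma 4.6 (p. 105)] [cite: AbbesUllmo1996, Thm. A] [cite: CoatesSujatha2005, Conj. A (shape)] -/
theorem ordKatoHalfAtTwoIsoPosDisc_of_relaxedZeta_of_lemma46_of_conjA_of_realSignature (hR : RelaxedZetaColemanIotaPosDiscAtTwo)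
    (h46 : lemma46_relaxed_mod_selmer_infinite_rat_two) (hQ : FineSelmerConjATwoOrdPosDisc) (hRinf : RealSignatureFineTwoOrdPosDisc)
    (hMod : nonempty_modularParametrizationData) (hAU : abbesUllmo_not_dvd_maninConstant_of_not_dvd_level)
    (h17 : ∀ (V : WeierstrassCurve ℚ) [V.IsElliptic] [V.IsGloballyMinimal] [NeZero (V.conductorNorm ℤ)]
      (f : CuspForm (Gamma0 (V.conductorNorm ℤ)) 2), kato_divisibility_allPrimes V 2 (f := f)) :
    OrdKatoHalfAtTwoIsoPosDisc :=
  ordKatoHalfAtTwoIsoPosDisc_of_relaxedColeman_of_relaxedConjA (relaxedColemanData_of_relaxedZeta_of_lemma46 hR h46 hMod h17)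
    (relaxedConjATwoPosDisc_of_conjA_of_realSignature hQ hRinf) hAU h17

/-- **The PAIR child `OrdKatoFineZetaAtTwoResidue` (stmt-BirchSwinnertonDyer-24097) BY NAME**: F1μι⁻ (conjunct 1 verbatim, memo) and the
relaxed-genuine road on conjunct 2 keyed on h46 (R⁺ + h46 + Q⁺ + R∞⁺ + modularity + Abbes–Ullmo + Kato 17.4 (1)(2)@2). CONDITIONAL; nothing
closed. [cite: Kato2004Asterisque, Thm. 12.6, 16.6, Prop. 17.11, §17.13 (shape)] [cite: GreenbergLNM1716, §4 Lemma 4.6 (p. 105)] -/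
theorem ordKatoFineZetaAtTwoResidue_of_negDisc_of_relaxedZeta_of_lemma46_of_conjA_of_realSignature
    (hNeg : ZetaColemanMuIotaNegDiscAtTwo) (hR : RelaxedZetaColemanIotaPosDiscAtTwo)
    (h46 : lemma46_relaxed_mod_selmer_infinite_rat_two) (hQ : FineSelmerConjATwoOrdPosDisc) (hRinf : RealSignatureFineTwoOrdPosDisc)
    (hMod : nonempty_modularParametrizationData) (hAU : abbesUllmo_not_dvd_maninConstant_of_not_dvd_level)
    (h17 : ∀ (V : WeierstrassCurve ℚ) [V.IsElliptic] [V.IsGloballyMinimal] [NeZero (V.conductorNorm ℤ)]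
      (f : CuspForm (Gamma0 (V.conductorNorm ℤ)) 2), kato_divisibility_allPrimes V 2 (f := f)) :
    OrdKatoFineZetaAtTwoResidue :=
  ordKatoFineZetaAtTwoResidue_of_halves hNeg
    (ordKatoHalfAtTwoIsoPosDisc_of_relaxedZeta_of_lemma46_of_conjA_of_realSignature hR h46 hQ hRinf hMod hAU h17)

end Summit.BirchSwinnertonDyer.BirchSwinnertonDyer.Theorems.SteinbergFibreAtTwo

end
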